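import Literature.Topology.FourManifolds.LefschetzBaseHomologyRank
import Literature.AlgebraicTopology.SingularHomology.IntersectionFormProofs
import Literature.AlgebraicTopology.SingularHomology.EulerCharacteristicTriple
import HarnessLib

/-!
# The standard Lefschetz base of genus `g`, XI: Betti numbers and Euler characteristic

Topic `Literature/Topology/FourManifolds`; namespace `Literature.Topology.FourManifolds.LefschetzBase`.
The remaining half of Milnor 1968, Thm. 9.1 for the concrete base
`Base g = {‖y² − x^{2g+1} − 1‖² + eta ‖x‖² ≤ 1/4} ⊂ ℂ²` (`LefschetzBaseModel.lean`,
`LefschetzBaseRegular.lean`): the base has the homology of the wedge `⋁^{2g} S¹` (the `A_{2g}`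
fibre `y² = x^{2g+1} + 1` is a once-punctured genus-`g` surface).  From the Milnor cover
`Base g = U ∪ V` with `U ≃ₕ Fin 2` (`LefschetzBaseCover.lean`), `V ≃ₕ Fin (2g+1)`
(`LefschetzBaseCoverSectors.lean`), `U ∩ V ≃ₕ Fin 2 × Fin (2g+1)` (`LefschetzBaseCoverOverlap.lean`)
and the Mayer–Vietoris sequence (Hatcher 2002, §2.2 pp. 149–150; the tree's
`mayerVietoris.exact₂_holds`):

* `isZero_singularHomology_succ_of_cover` — `Hₙ₊₁(U) = Hₙ₊₁(V) = 0`, `Hₙ(U ∩ V) = 0 ⟹ Hₙ₊₁(X) = 0`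
  for an open cover `X = U ∪ V` (any coefficients);
* **`isZero_singularHomology_base_of_two_le`** — `Hₖ(Base g; M) = 0` for every `k ≥ 2` and all
  coefficients (the pieces are homologically discrete);
* `finrank_singularHomology_base_zero` (`= 1`, the base is path connected, `LefschetzBaseHomologyRank.lean`
  §11), `finrank_singularHomology_base_one` (`= 2g`, `homologyOne_base`);
* **`bettiNumbers_base`** — the rational Betti numbers `b₀ = 1`, `b₁ = 2g`, `bₖ = 0` (`k ≥ 2`)
  (`bettiNumber_int_eq_rat`, Hatcher Cor. 3A.6), in the exact form consumed by the Euler-characteristic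
  count `l.length = 4g` of one-sided Lefschetz models of homotopy 4-spheres
  (`Summits/SmoothPoincare4/…/ConvexBisectionAcyclicBisectionExistsEulerCounts.lean`);
* `finRelHomology_base`, **`relEuler_base`** — `H_•(Base g; ℤ)` is finitely generated, zero from
  degree `2` on, and `χ(Base g) = 1 − 2g`.

Everything here is PROVED; nothing is asserted.

## References
* J. Milnor, *Singular points of complex hypersurfaces*, Ann. of Math. Studies 61 (1968), §9,
  Thm. 9.1, Lemma 9.2. [Milnor1968]
* A. Hatcher, *Algebraic Topology*, CUP 2002, §2.2 pp. 146, 149–150; §3.A Cor. 3A.6. [HatcherAT2002]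
-/

noncomputable section

open scoped Manifold ContDiff Topology
open Set Function Metric CategoryTheory CategoryTheory.Limits
open Literature.AlgebraicTopology.SingularHomology

universe u v

namespace Literature.Topology.FourManifolds

namespace LefschetzBase

/-! ## Mayer–Vietoris: vanishing above the homological dimension of the pieces -/

section MayerVietoris

variable (R : Type v) [CommRing R] (M : Type v) [AddCommGroup M] [Module R M]
variable {X : Type u} [TopologicalSpace X]

/-- **Mayer–Vietoris, vanishing criterion.**  For an open cover `X = U ∪ V`: if
`Hₙ₊₁(U; M) = Hₙ₊₁(V; M) = 0` and `Hₙ(U ∩ V; M) = 0` then `Hₙ₊₁(X; M) = 0` — in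
`Hₙ₊₁(U) ⊞ Hₙ₊₁(V) →ψ Hₙ₊₁(X) →δ Hₙ(U ∩ V)` the connecting map vanishes, so `ψ` is onto from a zero
object (Hatcher 2002, §2.2 p. 149; the tree's `mayerVietoris.exact₂_holds` and excision
`relativeSingularHomology.isIso_map_of_interior_union_interior_holds`).
[cite: HatcherAT2002, §2.2 p. 149] -/
theorem isZero_singularHomology_succ_of_cover (U V : Set X) (hU : IsOpen U) (hV : IsOpen V)
    (hUV : U ∪ V = univ) (n : ℕ) (hUn : IsZero (singularHomology R M U (n + 1)))
    (hVn : IsZero (singularHomology R M V (n + 1)))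
    (hW : IsZero (singularHomology R M ↥(U ∩ V) n)) :
    IsZero (singularHomology R M X (n + 1)) := by
  have h : interior U ∪ interior V = univ := by rw [hU.interior_eq, hV.interior_eq, hUV]
  have hexc := relativeSingularHomology.isIso_map_of_interior_union_interior_holds R M X
  have hδ : mayerVietoris.δ R M U V hexc h n = 0 := hW.eq_of_tgt _ _
  haveI : Epi (mayerVietoris.ψ R M U V (n + 1)) :=
    (mayerVietoris.exact₂_holds R M U V hexc h n).epi_f hδ
  exact IsZero.of_epi (mayerVietoris.ψ R M U V (n + 1)) ((biprod_isZero_iff _ _).2 ⟨hUn, hVn⟩)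

end MayerVietoris

/-! ## The homology of the base: `Hₖ = 0` for `k ≥ 2`, `rank H₀ = 1`, `rank H₁ = 2g` -/

section Homology

variable (R : Type v) [CommRing R] (M : Type v) [AddCommGroup M] [Module R M]

/-- **`Hₖ(Base g; M) = 0` for every `k ≥ 2` and all coefficients** (Milnor 1968, Thm. 9.1: the
base has the homotopy type of the bouquet `⋁^{2g} S¹`).  Mayer–Vietoris for the Milnor cover
`Base g = U ∪ V`: `U ≃ₕ Fin 2`, `V ≃ₕ Fin (2g+1)` and `U ∩ V ≃ₕ Fin 2 × Fin (2g+1)` are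
homologically discrete, so `Hₖ(U) = Hₖ(V) = 0` and `Hₖ₋₁(U ∩ V) = 0` for `k ≥ 2`.
[cite: Milnor1968, Thm. 9.1] -/
theorem isZero_singularHomology_base_of_two_le (g : ℕ) {k : ℕ} (hk : 2 ≤ k) :
    IsZero (singularHomology R M (Base g) k) := by
  obtain ⟨n, rfl⟩ : ∃ n, k = n + 1 + 1 := ⟨k - 2, by omega⟩
  have hU : ContinuousMap.HomotopyEquiv ↥(coverU g) (Fin 2) := homotopyEquivU g
  have hV : ContinuousMap.HomotopyEquiv ↥(coverV g) (Fin (2 * g + 1)) := homotopyEquivV g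
  have hW : ContinuousMap.HomotopyEquiv ↥(coverU g ∩ coverV g) (Fin 2 × Fin (2 * g + 1)) :=
    homotopyEquivW g
  refine isZero_singularHomology_succ_of_cover R M (coverU g) (coverV g) (isOpen_coverU g)
    (isOpen_coverV g) (coverU_union_coverV g) (n + 1) ?_ ?_ ?_
  · exact (singularHomology.isZero_fin R M 2 (Nat.succ_ne_zero _)).of_iso
      (singularHomology.isoOfHomotopyEquiv R M hU _)
  · exact (singularHomology.isZero_fin R M (2 * g + 1) (Nat.succ_ne_zero _)).of_iso
      (singularHomology.isoOfHomotopyEquiv R M hV _)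
  · exact (isZero_singularHomology_of_totallyDisconnectedSpace R M (Nat.succ_ne_zero _)).of_iso
      (singularHomology.isoOfHomotopyEquiv R M hW _)

/-- **`rank H₀(Base g; R) = 1`**: the base is path connected (`pathConnectedSpace_base`), so the
augmentation is an isomorphism `H₀(Base g; R) ≅ R` (Hatcher 2002, Prop. 2.7).
[cite: HatcherAT2002, Prop. 2.7] -/
theorem finrank_singularHomology_base_zero [Nontrivial R] (g : ℕ) :
    Module.finrank R (singularHomology R R (Base g) 0) = 1 := by
  rw [(singularHomology.zeroLinearEquivOfPathConnected R R (Base g)).finrank_eq, Module.finrank_self]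

/-- **`rank H₁(Base g; ℤ) = 2g`** (Milnor 1968, Thm. 9.1: `rank = μ = 2g`; the tree's
`homologyOne_base`). [cite: Milnor1968, Thm. 9.1] -/
theorem finrank_singularHomology_base_one (g : ℕ) :
    Module.finrank ℤ (singularHomology ℤ ℤ (Base g) 1) = 2 * g :=
  (homologyOne_base g).2.2

/-- `H₁(Base g; ℤ)` is a finitely generated `ℤ`-module (the tree's `homologyOne_base`).
[cite: Milnor1968, Thm. 9.1] -/
theorem finite_singularHomology_base_one (g : ℕ) : Module.Finite ℤ (singularHomology ℤ ℤ (Base g) 1) :=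
  (homologyOne_base g).1

/-- `H₁(Base g; ℤ)` is a free `ℤ`-module (the tree's `homologyOne_base`). [cite: Milnor1968, Thm. 9.1] -/
theorem free_singularHomology_base_one (g : ℕ) : Module.Free ℤ (singularHomology ℤ ℤ (Base g) 1) :=
  (homologyOne_base g).2.1

end Homology

/-! ## Betti numbers -/

section Betti

/-- **`bₖ(Base g; R) = 0` for `k ≥ 2`** and every non-trivial coefficient ring.
[cite: Milnor1968, Thm. 9.1] -/
theorem bettiNumber_base_of_two_le (R : Type v) [CommRing R] [Nontrivial R] (g : ℕ) {k : ℕ}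
    (hk : 2 ≤ k) : bettiNumber R (Base g) k = 0 :=
  finrank_eq_zero_of_isZero (isZero_singularHomology_base_of_two_le R R g hk)

/-- **`b₀(Base g; R) = 1`** for every non-trivial coefficient ring (the base is path connected).
[cite: HatcherAT2002, Prop. 2.7] -/
theorem bettiNumber_base_zero (R : Type v) [CommRing R] [Nontrivial R] (g : ℕ) :
    bettiNumber R (Base g) 0 = 1 :=
  finrank_singularHomology_base_zero R g

/-- **`b₁(Base g; ℤ) = 2g`**. [cite: Milnor1968, Thm. 9.1] -/
theorem bettiNumber_int_base_one (g : ℕ) : bettiNumber ℤ (Base g) 1 = 2 * g :=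
  finrank_singularHomology_base_one g

/-- **`b₁(Base g; ℚ) = 2g`**: `dim H₁(·; ℚ) = rank H₁(·; ℤ)` (Hatcher 2002, Cor. 3A.6 (a); the
tree's `bettiNumber_int_eq_rat`). [cite: HatcherAT2002, §3.A Cor. 3A.6 (a)] -/
theorem bettiNumber_rat_base_one (g : ℕ) : bettiNumber ℚ (Base g) 1 = 2 * g := by
  rw [← bettiNumber_int_eq_rat, bettiNumber_int_base_one]

/-- **The rational Betti numbers of the standard Lefschetz base**: `b₀ = 1`, `b₁ = 2g`, `bₖ = 0`
for `k ≥ 2` (Milnor 1968, Thm. 9.1: `Base g ≃ ⋁^{2g} S¹`), in the form consumed by the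
Euler-characteristic count of one-sided Lefschetz models (`…EulerCounts.lean`, hypothesis `hB`).
[cite: Milnor1968, Thm. 9.1] -/
theorem bettiNumbers_base (g : ℕ) :
    bettiNumber ℚ (Base g) 0 = 1 ∧ bettiNumber ℚ (Base g) 1 = 2 * g ∧
      ∀ k, 2 ≤ k → bettiNumber ℚ (Base g) k = 0 :=
  ⟨bettiNumber_base_zero ℚ g, bettiNumber_rat_base_one g, fun _ hk => bettiNumber_base_of_two_le ℚ g hk⟩

end Betti

/-! ## The Euler characteristic `χ(Base g) = 1 − 2g` -/

section Euler

/-- **`H_•(Base g; ℤ)` is finitely generated in every degree and vanishes from degree `2` on**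
(`FinRelHomology ℤ ℤ (Base g) ∅ 2`): `H₀ ≅ ℤ`, `H₁ ≅ ℤ^{2g}`, `Hₖ = 0` for `k ≥ 2`.
[cite: Milnor1968, Thm. 9.1] -/
theorem finRelHomology_base (g : ℕ) : FinRelHomology ℤ ℤ (Base g) ∅ 2 := by
  refine FinRelHomology.empty_of_absolute (fun k => ?_)
    fun k hk => isZero_singularHomology_base_of_two_le ℤ ℤ g hk
  rcases Nat.lt_or_ge k 2 with hk | hk
  · interval_cases k
    · exact Module.Finite.equiv (singularHomology.zeroLinearEquivOfPathConnected ℤ ℤ (Base g)).symm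
    · exact finite_singularHomology_base_one g
  · exact finite_of_isZero (isZero_singularHomology_base_of_two_le ℤ ℤ g hk)

/-- **`χ(Base g) = 1 − 2g`** (Milnor 1968, Thm. 9.1: `χ = 1 − μ`, `μ = 2g`; the base is a
4-dimensional thickening of the once-punctured genus-`g` surface): `χ = rank H₀ − rank H₁ = 1 − 2g`.
[cite: Milnor1968, Thm. 9.1] -/
theorem relEuler_base (g : ℕ) : relEuler ℤ ℤ (Base g) ∅ = 1 - 2 * g := by
  rw [(finRelHomology_base g).relEuler_empty_eq_sum, Finset.sum_range_succ, Finset.sum_range_succ,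
    Finset.sum_range_zero, finrank_singularHomology_base_zero, finrank_singularHomology_base_one]
  push_cast
  ring

end Euler

end LefschetzBase

end Literature.Topology.FourManifolds
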